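import Summits.ABC.ABC.Statement
import Literature.NumberTheory.DiophantineGeometry.AbcWave0MihailescuProofs
import HarnessLib
import Literature.Uncategorized.ABCAtLeastThreePrimes

/-!
# abc below three primes is a theorem; the summit lives at `ω(abc) ≥ 3` (solo-ABC-blind, generation 5)

The **ω-axis** of the wall.  Write `ω(abc) = #(abc).primeFactors` for an abc triple `a + b = c`
(coprime positive naturals).

* `eq_one_or_eq_one_of_card_le_two` — if `ω(abc) ≤ 2` then `a = 1` or `b = 1` (else three pairwise coprime numbers `≥ 2`).
* `primePow_of_card_le_two` — if `ω(b(b+1)) ≤ 2` and `b ≥ 2` then `b = p^m`, `b + 1 = q^n` are prime powers.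
* `two_mul_le_three_mul_rad_of_card_le_two` — **abc with `(ε, C) = (0, 3/2)` holds on `ω(abc) ≤ 2`:**
  `2c ≤ 3·rad(abc)`.  Inputs: the two items above and Mihăilescu's theorem (Catalan's conjecture), which is a
  THEOREM of the Literature library (`Literature.NumberTheory.DiophantineGeometry.mihailescu_holds`, R. Schoof,
  *Catalan's Conjecture*, Universitext 2009, formalised in the `Catalan*` files): the case `m, n ≥ 2` of
  `q^n = p^m + 1` is `9 = 8 + 1`; the cases `m = 1` or `n = 1` are trivial (`c ≤ rad` or `c = p + 1`).
* `card_le_two_sharp` — equality at `1 + 8 = 9` (`ω = 2`, `rad = 6`), so `3/2` is optimal.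
* `card_le_two_classification` — the abc triples `1 + b = c`, `b ≥ 2`, supported on at most two primes are
  exactly `1 + 8 = 9`, `1 + M = 2^n` with `M` prime (Mersenne primes) and `1 + 2^m = F` with `F` prime (Fermat
  primes and `1 + 2 = 3`); with `1 + 1 = 2` and the swap `a ↔ b` this is the complete list.
* `abc_lt_of_card_le_two`, `abc_iff_abcAtLeastThreePrimes` — consequently **`ABC` is equivalent to its
  restriction to triples with `ω(abc) ≥ 3`** (`ABCAtLeastThreePrimes`); the constant on `ω ≤ 2` is `2`, uniform
  in `ε`.
* `card_three_example` — at `ω = 3` the inequality `2c ≤ 3 rad` already fails: the Fermat–Catalan solution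
  `2^5 + 7^2 = 3^4` (Darmon–Granville, Bull. LMS 27 (1995) p. 515) has `rad = 42`, `c = 81`.

For the wall (what a proof must do): since exactly one of `a, b, c` is even, `ω(abc) = 3` means support
`{2, p, q}`; this first open case already contains the distance-2 Pillai family `p^a = q^b + 2`
(`Summit.ABC.ABC.Theorems.pillaiTail_finite_of_polyABC`, generation 2: even a polynomial abc inequality on it is
a case of Pillai's conjecture), prime-base Fermat–Catalan equations `2^k ± p^m = ± q^n`, and `q^n − 1 = 2^k p^m`.
On `ω = 3` the best unconditional bounds are `log c ≪ log p · log q · log log c` when the lone even term is a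
power of `2` standing alone (linear forms in three logarithms, archimedean or `2`-adic), and
`log c ≪ p_min · (log p · log q) · log log c` when an odd prime power `p_min^m` is the smallest term (the
`p`-adic estimate carries the factor `p / log p`): the product-of-heights and the `N(p)/log N(p)` defects of the
transcendence method are both visible at three primes, and nothing polynomial in `rad = 2pq` is known there.
-/

open UniqueFactorizationMonoid Finset

namespace Summit.ABC.ABC.Theorems

open Literature.NumberTheory.DiophantineGeometry

/-- **In an abc triple supported on at most two primes one summand is `1`:** otherwise `a, b, c ≥ 2` are
pairwise coprime and contribute three distinct primes. [folklore] -/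
theorem eq_one_or_eq_one_of_card_le_two {a b c : ℕ} (h : IsABCTriple a b c)
    (hω : (a * b * c).primeFactors.card ≤ 2) : a = 1 ∨ b = 1 := by
  obtain ⟨ha0, hb0, habc, hab⟩ := h
  by_contra hne
  have ha : 2 ≤ a := by
    rcases Nat.lt_or_ge a 2 with h2 | h2
    · exact absurd (Or.inl (by omega)) hne
    · exact h2
  have hb : 2 ≤ b := by
    rcases Nat.lt_or_ge b 2 with h2 | h2
    · exact absurd (Or.inr (by omega)) hne
    · exact h2
  have hac : Nat.Coprime a c := by rw [← habc]; exact Nat.coprime_self_add_right.mpr hab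
  have hbc : Nat.Coprime b c := by rw [← habc]; exact Nat.coprime_add_self_right.mpr hab.symm
  obtain ⟨p, hp⟩ := Nat.nonempty_primeFactors.mpr (by omega : 1 < a)
  obtain ⟨q, hq⟩ := Nat.nonempty_primeFactors.mpr (by omega : 1 < b)
  obtain ⟨r, hr⟩ := Nat.nonempty_primeFactors.mpr (by omega : 1 < c)
  have hp' := Nat.mem_primeFactors.mp hp
  have hq' := Nat.mem_primeFactors.mp hq
  have hr' := Nat.mem_primeFactors.mp hr
  have hn0 : a * b * c ≠ 0 := mul_ne_zero (mul_ne_zero (by omega) (by omega)) (by omega)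
  have hpS : p ∈ (a * b * c).primeFactors :=
    Nat.mem_primeFactors.mpr ⟨hp'.1, (hp'.2.1.mul_right b).mul_right c, hn0⟩
  have hqS : q ∈ (a * b * c).primeFactors :=
    Nat.mem_primeFactors.mpr ⟨hq'.1, (hq'.2.1.mul_left a).mul_right c, hn0⟩
  have hrS : r ∈ (a * b * c).primeFactors :=
    Nat.mem_primeFactors.mpr ⟨hr'.1, hr'.2.1.mul_left (a * b), hn0⟩
  have hpq : p ≠ q := by
    rintro rfl; exact hp'.1.one_lt.ne' (Nat.Coprime.eq_one_of_dvd (Nat.Coprime.coprime_dvd_left hp'.2.1 hab) hq'.2.1)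
  have hpr : p ≠ r := by
    rintro rfl; exact hp'.1.one_lt.ne' (Nat.Coprime.eq_one_of_dvd (Nat.Coprime.coprime_dvd_left hp'.2.1 hac) hr'.2.1)
  have hqr : q ≠ r := by
    rintro rfl; exact hq'.1.one_lt.ne' (Nat.Coprime.eq_one_of_dvd (Nat.Coprime.coprime_dvd_left hq'.2.1 hbc) hr'.2.1)
  have h3 : ({p, q, r} : Finset ℕ).card = 3 := Finset.card_eq_three.mpr ⟨p, q, r, hpq, hpr, hqr, rfl⟩
  have hsub : ({p, q, r} : Finset ℕ) ⊆ (a * b * c).primeFactors := by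
    intro x hx
    simp only [Finset.mem_insert, Finset.mem_singleton] at hx
    rcases hx with rfl | rfl | rfl
    exacts [hpS, hqS, hrS]
  have := h3 ▸ Finset.card_le_card hsub
  omega

/-- **Two consecutive integers supported on two primes are prime powers.** If `b ≥ 2` and `b(b+1)` has at
most two prime factors, then `b = p^m` and `b + 1 = q^n` with `p ≠ q` primes and `m, n ≥ 1`. [folklore] -/
theorem primePow_of_card_le_two {b c : ℕ} (hb : 2 ≤ b) (hbc : b + 1 = c)
    (hω : (b * c).primeFactors.card ≤ 2) :
    ∃ p q m n : ℕ, p.Prime ∧ q.Prime ∧ p ≠ q ∧ 1 ≤ m ∧ 1 ≤ n ∧ b = p ^ m ∧ c = q ^ n := by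
  have hcop : Nat.Coprime b c := by
    rw [← hbc]; exact Nat.coprime_self_add_right.mpr (Nat.coprime_one_right b)
  obtain ⟨p, hp⟩ := Nat.nonempty_primeFactors.mpr (by omega : 1 < b)
  obtain ⟨q, hq⟩ := Nat.nonempty_primeFactors.mpr (by omega : 1 < c)
  have hp' := Nat.mem_primeFactors.mp hp
  have hq' := Nat.mem_primeFactors.mp hq
  have hn0 : b * c ≠ 0 := mul_ne_zero (by omega) (by omega)
  have hpq : p ≠ q := by
    rintro rfl; exact hp'.1.one_lt.ne' (Nat.Coprime.eq_one_of_dvd (Nat.Coprime.coprime_dvd_left hp'.2.1 hcop) hq'.2.1)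
  have hpS : p ∈ (b * c).primeFactors := Nat.mem_primeFactors.mpr ⟨hp'.1, hp'.2.1.mul_right c, hn0⟩
  have hqS : q ∈ (b * c).primeFactors := Nat.mem_primeFactors.mpr ⟨hq'.1, hq'.2.1.mul_left b, hn0⟩
  -- every prime factor of `b * c` is `p` or `q`
  have hS : ∀ d, d.Prime → d ∣ b * c → d = p ∨ d = q := by
    intro d hd hdvd
    have hdS : d ∈ (b * c).primeFactors := Nat.mem_primeFactors.mpr ⟨hd, hdvd, hn0⟩
    by_contra hne
    have hne1 : d ≠ p := fun e => hne (Or.inl e)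
    have hne2 : d ≠ q := fun e => hne (Or.inr e)
    have h3 : ({p, q, d} : Finset ℕ).card = 3 :=
      Finset.card_eq_three.mpr ⟨p, q, d, hpq, fun e => hne1 e.symm, fun e => hne2 e.symm, rfl⟩
    have hsub : ({p, q, d} : Finset ℕ) ⊆ (b * c).primeFactors := by
      intro x hx
      simp only [Finset.mem_insert, Finset.mem_singleton] at hx
      rcases hx with rfl | rfl | rfl
      exacts [hpS, hqS, hdS]
    have := Finset.card_le_card hsub
    omega
  have hbpow : b = p ^ b.primeFactorsList.length := by
    refine Nat.eq_prime_pow_of_unique_prime_dvd (by omega) ?_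
    intro d hd hdb
    rcases hS d hd (hdb.mul_right c) with h | h
    · exact h
    · exfalso
      have hqb : q ∣ b := by rw [← h]; exact hdb
      exact hq'.1.one_lt.ne' (Nat.Coprime.eq_one_of_dvd (Nat.Coprime.coprime_dvd_left hqb hcop) hq'.2.1)
  have hcpow : c = q ^ c.primeFactorsList.length := by
    refine Nat.eq_prime_pow_of_unique_prime_dvd (by omega) ?_
    intro d hd hdc
    rcases hS d hd (hdc.mul_left b) with h | h
    · exfalso
      have hpc : p ∣ c := by rw [← h]; exact hdc
      exact hp'.1.one_lt.ne' (Nat.Coprime.eq_one_of_dvd (Nat.Coprime.coprime_dvd_left hp'.2.1 hcop) hpc)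
    · exact h
  refine ⟨p, q, _, _, hp'.1, hq'.1, hpq, ?_, ?_, hbpow, hcpow⟩
  · by_contra h0
    have h00 : b.primeFactorsList.length = 0 := by omega
    rw [h00, pow_zero] at hbpow
    omega
  · by_contra h0
    have h00 : c.primeFactorsList.length = 0 := by omega
    rw [h00, pow_zero] at hcpow
    omega

/-- The case `a = 1` of the two-prime inequality: `b + 1 = c`, `ω(bc) ≤ 2` ⟹ `2c ≤ 3 rad(bc)`.
Mihăilescu's theorem settles the sub-case of two proper prime powers. [folklore] -/
theorem two_mul_le_three_mul_radical_aux {b c : ℕ} (hb : 0 < b) (hbc : b + 1 = c)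
    (hω : (b * c).primeFactors.card ≤ 2) : 2 * c ≤ 3 * radical (b * c) := by
  rcases Nat.lt_or_ge b 2 with hb1 | hb2
  · -- `b = 1`, `c = 2`
    obtain rfl : b = 1 := by omega
    obtain rfl : c = 2 := by omega
    have : radical ((1 : ℕ) * 2) = 2 := by
      rw [one_mul, Nat.radical_eq_prod_primeFactors, Nat.prime_two.primeFactors, Finset.prod_singleton]
    omega
  · obtain ⟨p, q, m, n, hp, hq, hpq, hm, hn, hbpm, hcqn⟩ := primePow_of_card_le_two hb2 hbc hω
    have hcop : Nat.Coprime b c := by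
      rw [← hbc]; exact Nat.coprime_self_add_right.mpr (Nat.coprime_one_right b)
    have hradp : radical b = p := by
      rw [hbpm, radical_pow _ (by omega : m ≠ 0), Nat.radical_eq_prod_primeFactors, hp.primeFactors,
        Finset.prod_singleton]
    have hradq : radical c = q := by
      rw [hcqn, radical_pow _ (by omega : n ≠ 0), Nat.radical_eq_prod_primeFactors, hq.primeFactors,
        Finset.prod_singleton]
    have hrad : radical (b * c) = p * q := by
      rw [radical_mul (Nat.coprime_iff_isRelPrime.mp hcop), hradp, hradq]
    rw [hrad]
    have hp2 := hp.two_le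
    have hq2 := hq.two_le
    rcases Nat.lt_or_ge n 2 with hn1 | hn2
    · -- `n = 1`: `c = q ≤ rad`
      obtain rfl : n = 1 := by omega
      rw [pow_one] at hcqn
      calc 2 * c = 2 * q := by rw [hcqn]
        _ ≤ (3 * p) * q := Nat.mul_le_mul_right q (by omega)
        _ = 3 * (p * q) := by ring
    · rcases Nat.lt_or_ge m 2 with hm1 | hm2
      · -- `m = 1`: `c = p + 1`
        obtain rfl : m = 1 := by omega
        rw [pow_one] at hbpm
        have hc : c = p + 1 := by omega
        calc 2 * c = 2 * (p + 1) := by rw [hc]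
          _ ≤ 3 * (p * 2) := by omega
          _ ≤ 3 * (p * q) := Nat.mul_le_mul_left 3 (Nat.mul_le_mul_left p hq2)
      · -- `m, n ≥ 2`: Mihăilescu ⟹ `9 = 8 + 1`
        have hM : ∀ {x y a b : ℕ}, 0 < y → 2 ≤ a → 2 ≤ b → x ^ a = y ^ b + 1 →
            x = 3 ∧ a = 2 ∧ y = 2 ∧ b = 3 :=
          Literature.NumberTheory.DiophantineGeometry.mihailescu_holds
        have heq : q ^ n = p ^ m + 1 := by rw [← hcqn, ← hbpm, hbc]
        obtain ⟨rfl, rfl, rfl, rfl⟩ := hM hp.pos hn2 hm2 heq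
        rw [hcqn]; norm_num

/-- **abc with `(ε, C) = (0, 3/2)` holds for triples supported on at most two primes:** if `a + b = c` is
an abc triple and `abc` has at most two prime factors then `2c ≤ 3·rad(abc)`. [folklore] -/
theorem two_mul_le_three_mul_rad_of_card_le_two {a b c : ℕ} (h : IsABCTriple a b c)
    (hω : (a * b * c).primeFactors.card ≤ 2) : 2 * c ≤ 3 * rad a b c := by
  have h1 := eq_one_or_eq_one_of_card_le_two h hω
  obtain ⟨ha, hb, habc, hab⟩ := h
  rw [rad_def]
  rcases h1 with rfl | rfl
  · rw [one_mul] at hω ⊢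
    exact two_mul_le_three_mul_radical_aux hb (by omega) hω
  · rw [mul_one] at hω ⊢
    exact two_mul_le_three_mul_radical_aux ha (by omega) hω

/-- Equality in `2c ≤ 3 rad(abc)` at the triple `1 + 8 = 9` (`ω = 2`, `rad = 6`). [folklore] -/
theorem card_le_two_sharp :
    IsABCTriple 1 8 9 ∧ (1 * 8 * 9).primeFactors.card = 2 ∧ 2 * 9 = 3 * rad 1 8 9 := by
  have hpf : (1 * 8 * 9 : ℕ).primeFactors = {2, 3} := by
    rw [show (1 * 8 * 9 : ℕ) = 2 ^ 3 * 3 ^ 2 by norm_num, Nat.primeFactors_mul (by norm_num) (by norm_num),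
      Nat.primeFactors_prime_pow (by norm_num) Nat.prime_two,
      Nat.primeFactors_prime_pow (by norm_num) Nat.prime_three]
    decide
  refine ⟨⟨by norm_num, by norm_num, by norm_num, by decide⟩, by rw [hpf]; decide, ?_⟩
  rw [rad_def, Nat.radical_eq_prod_primeFactors, hpf]
  decide

/-- **Classification below three primes.** If `b ≥ 2` and `b(b+1)` has at most two prime factors, then
`(b, b+1) = (8, 9)`, or `b` is prime and `b + 1` is a power of `2` (Mersenne), or `b + 1` is prime and `b` is
a power of `2` (Fermat, and `2 + 1 = 3`).  Inputs: `primePow_of_card_le_two`, parity, Mihăilescu. [folklore] -/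
theorem card_le_two_classification {b c : ℕ} (hb : 2 ≤ b) (hbc : b + 1 = c)
    (hω : (b * c).primeFactors.card ≤ 2) :
    (b = 8 ∧ c = 9) ∨ (b.Prime ∧ ∃ n : ℕ, c = 2 ^ n) ∨ (c.Prime ∧ ∃ m : ℕ, b = 2 ^ m) := by
  obtain ⟨p, q, m, n, hp, hq, hpq, hm, hn, hbpm, hcqn⟩ := primePow_of_card_le_two hb hbc hω
  have hM : ∀ {x y a b : ℕ}, 0 < y → 2 ≤ a → 2 ≤ b → x ^ a = y ^ b + 1 →
      x = 3 ∧ a = 2 ∧ y = 2 ∧ b = 3 :=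
    Literature.NumberTheory.DiophantineGeometry.mihailescu_holds
  by_cases hm2 : 2 ≤ m
  · by_cases hn2 : 2 ≤ n
    · -- Mihăilescu
      have heq : q ^ n = p ^ m + 1 := by rw [← hcqn, ← hbpm, hbc]
      obtain ⟨rfl, rfl, rfl, rfl⟩ := hM hp.pos hn2 hm2 heq
      left
      exact ⟨by rw [hbpm]; norm_num, by rw [hcqn]; norm_num⟩
    · -- `n = 1`: `c` prime, `b = p ^ m`; parity forces `p = 2`
      obtain rfl : n = 1 := by omega
      rw [pow_one] at hcqn
      have hcP : c.Prime := by rw [hcqn]; exact hq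
      right; right
      refine ⟨hcP, m, ?_⟩
      rcases hp.eq_two_or_odd' with h2 | hodd
      · rw [hbpm, h2]
      · exfalso
        have hc_even : Even c := by rw [← hbc, hbpm]; exact hodd.pow.add_one
        rcases hcP.eq_two_or_odd' with h2 | hodd'
        · omega
        · exact (Nat.not_even_iff_odd.mpr hodd') hc_even
  · obtain rfl : m = 1 := by omega
    rw [pow_one] at hbpm
    have hbP : b.Prime := by rw [hbpm]; exact hp
    by_cases hn2 : 2 ≤ n
    · -- `c = q ^ n = b + 1` with `b` prime: `b = 2` is impossible, `b` odd forces `q = 2`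
      right; left
      refine ⟨hbP, n, ?_⟩
      rcases hbP.eq_two_or_odd' with h2 | hodd
      · exfalso
        have hc3 : c = 3 := by omega
        have h4 : 2 ^ n ≤ q ^ n := Nat.pow_le_pow_left hq.two_le n
        have h4' : 2 ^ 2 ≤ 2 ^ n := Nat.pow_le_pow_right (by norm_num) hn2
        rw [← hcqn] at h4
        norm_num at h4'
        omega
      · have hc_even : Even c := by rw [← hbc]; exact hodd.add_one
        have h2c : 2 ∣ q ^ n := by rw [← hcqn]; exact even_iff_two_dvd.mp hc_even
        have h2q : 2 ∣ q := Nat.prime_two.dvd_of_dvd_pow h2c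
        have hq2 : q = 2 := ((Nat.prime_dvd_prime_iff_eq Nat.prime_two hq).mp h2q).symm
        rw [hcqn, hq2]
    · obtain rfl : n = 1 := by omega
      rw [pow_one] at hcqn
      have hcP : c.Prime := by rw [hcqn]; exact hq
      -- `b` and `b + 1` both prime: `b = 2`
      right; right
      refine ⟨hcP, 1, ?_⟩
      rcases hbP.eq_two_or_odd' with h2 | hodd
      · simpa using h2
      · exfalso
        have hc_even : Even c := by rw [← hbc]; exact hodd.add_one
        rcases hcP.eq_two_or_odd' with h2 | hodd'
        · omega
        · exact (Nat.not_even_iff_odd.mpr hodd') hc_even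

/-- **The ε-form on `ω ≤ 2`, constant `2` uniform in `ε`:** `c < 2 · rad(abc)^(1+ε)`. [folklore] -/
theorem abc_lt_of_card_le_two {ε : ℝ} (hε : 0 < ε) {a b c : ℕ} (h : IsABCTriple a b c)
    (hω : (a * b * c).primeFactors.card ≤ 2) :
    (c : ℝ) < 2 * ((rad a b c : ℕ) : ℝ) ^ (1 + ε) := by
  have h1 : ((2 * c : ℕ) : ℝ) ≤ ((3 * rad a b c : ℕ) : ℝ) := by
    exact_mod_cast two_mul_le_three_mul_rad_of_card_le_two h hω
  push_cast at h1
  have hpos : 0 < rad a b c := Nat.radical_pos _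
  have hr1 : (1 : ℝ) ≤ ((rad a b c : ℕ) : ℝ) := by exact_mod_cast hpos
  have hr2 : ((rad a b c : ℕ) : ℝ) ≤ ((rad a b c : ℕ) : ℝ) ^ (1 + ε) :=
    Real.self_le_rpow_of_one_le hr1 (by linarith)
  linarith

/-- **`ABC` is equivalent to its restriction to `ω(abc) ≥ 3`** (the triples with `ω ≤ 2` satisfy
`c < 2 rad^(1+ε)` unconditionally). [folklore] -/
theorem abc_iff_abcAtLeastThreePrimes : ABC ↔ Literature.Uncategorized.ABCAtLeastThreePrimes := by
  rw [ABC_iff]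
  constructor
  · intro h ε hε
    obtain ⟨C, hC, H⟩ := h ε hε
    exact ⟨C, hC, fun a b c ht _ => H a b c ht⟩
  · intro h ε hε
    obtain ⟨C₁, hC₁, H⟩ := h ε hε
    refine ⟨max C₁ 2, lt_max_iff.mpr (Or.inr two_pos), fun a b c ht => ?_⟩
    have hR : 0 ≤ ((rad a b c : ℕ) : ℝ) ^ (1 + ε) := Real.rpow_nonneg (Nat.cast_nonneg _) _
    rcases Nat.lt_or_ge ((a * b * c).primeFactors.card) 3 with hlt | hge
    · calc ((c : ℕ) : ℝ) < 2 * ((rad a b c : ℕ) : ℝ) ^ (1 + ε) := abc_lt_of_card_le_two hε ht (by omega)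
        _ ≤ max C₁ 2 * ((rad a b c : ℕ) : ℝ) ^ (1 + ε) := mul_le_mul_of_nonneg_right (le_max_right _ _) hR
    · exact (H a b c ht hge).trans_le (mul_le_mul_of_nonneg_right (le_max_left _ _) hR)

/-- **At three primes the constant `3/2` fails:** the Fermat–Catalan solution `2^5 + 7^2 = 3^4` is an abc
triple with `ω = 3`, `rad = 42 < 81 = c`, indeed `3 rad < 2c`. [folklore] -/
theorem card_three_example :
    IsABCTriple 32 49 81 ∧ (32 * 49 * 81).primeFactors.card = 3 ∧ 3 * rad 32 49 81 < 2 * 81 := by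
  have hpf : (32 * 49 * 81 : ℕ).primeFactors = {2, 7, 3} := by
    rw [show (32 * 49 * 81 : ℕ) = (2 ^ 5 * 7 ^ 2) * 3 ^ 4 by norm_num,
      Nat.primeFactors_mul (by norm_num) (by norm_num),
      Nat.primeFactors_mul (by norm_num) (by norm_num),
      Nat.primeFactors_prime_pow (by norm_num) Nat.prime_two,
      Nat.primeFactors_prime_pow (by norm_num) (by norm_num : Nat.Prime 7),
      Nat.primeFactors_prime_pow (by norm_num) Nat.prime_three]
    decide
  refine ⟨⟨by norm_num, by norm_num, by norm_num, by decide⟩, by rw [hpf]; decide, ?_⟩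
  rw [rad_def, Nat.radical_eq_prod_primeFactors, hpf]
  decide

end Summit.ABC.ABC.Theorems
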